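import Summits.ResolutionOfSingularities.ResolutionOfSingularities.Theorems.FrobeniusLadderFInjectiveMacaulayficationClosedPointLocalResolutionAdmTr
import Summits.ResolutionOfSingularities.ResolutionOfSingularities.Theorems.FrobeniusLadderFInjectiveMacaulayficationLocalBlowupDesingularizationDimThree
import HarnessLib

/-!
# SANITY FLOOR OF THE (LR_adm) LADDER: the level `e = 3` of the closed-point rung is a THEOREM modulo the threefold package
# (crux `FInjectiveMacaulayfication` stmt-ResolutionOfSingularities-15315, chain w45a; res-L1-w45a-plan-1 CRUX-PLAN v31.1 §B/§D «sanity floor e ≤ 3 ⟸ CP (KNOWN)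
# optional»; seat res-L1-w45a-stub-3 g8)

[OURS · L1 W4.5a] Support file (`--supports stmt-ResolutionOfSingularities-15315 --as helper`); replaces the role of NO printed item; NOT a statement of any
manuscript; def-free; CONDITIONAL on {CP 2019 Thm. 1.1 (i)(ii), Raynaud–Gruson 5.2.2, CP 2019 Prop. 4.4} BY NAME. AI-written (AI review is weaker than expert review).

The ladder under (LR_adm) (`ClosedPointLocalResolutionAdm p e`, p598957; `ClosedPointLocalResolutionAdmTr p e r`, p602502) is consumed at the levels `e ≥ 4`
only. At the level `e = 3` BOTH rungs are theorems modulo the threefold package: every blowing up of `Spec 𝒪_{Y,y}` with `dim 𝒪_{Y,y} = 3` admits a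
desingularization (`LocalBlowupDesingularizationDimThree.admitsDesingularization_of_isBlowup_stalk_dimThree`, Cossart–Piltant; no admissibility or fibre
hypothesis needed), and a closed point of an integral finite-type `3`-fold has local dimension `3` (`FTemkinClosedPoints.ringKrullDim_stalk_eq_of_isClosed`).
The levels `e ≤ 2` are not stated here: the tree's one-blow-up desingularization lemma is typed at dimension `= 3` (CP 2019 Prop. 4.4 is a threefold
principalization), and the door never consumes a level below `4`.

* `closedPointLocalResolutionAdm_three_of_cp (hG h081R hP) (p) : ClosedPointLocalResolutionAdm p 3`;
* `closedPointLocalResolutionAdmTr_three_of_cp (hG h081R hP) (p r) : ClosedPointLocalResolutionAdmTr p 3 r`.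

[cite: CossartPiltant2019, Thm. 1.1 (i)(ii); Prop. 4.4] [cite: Temkin2008, Prop. 2.3.4 (iii); Def. 2.2.6] [cite: GortzWedhorn2020, Thm. 5.22]
-/

-- single-problem summit: the doubled namespace component is forced
set_option linter.dupNamespace false

noncomputable section

namespace Summit.ResolutionOfSingularities.ResolutionOfSingularities.Theorems.FInjectiveMacaulayfication.ClosedPointLocalResolutionAdmDimThree

open CategoryTheory AlgebraicGeometry TopologicalSpace IsLocalRing
open Literature.AlgebraicGeometry.Resolution
open Summit.ResolutionOfSingularities.ResolutionOfSingularities.Theorems.FInjectiveMacaulayfication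

/-- **Level `3` of the all-fields rung is a theorem** modulo {CP 1.1, R–G 081R, CP 4.4}. [OURS · conditional-result]
[cite: CossartPiltant2019, Thm. 1.1 (i)(ii); Prop. 4.4] [cite: Temkin2008, Prop. 2.3.4 (iii)] -/
theorem closedPointLocalResolutionAdm_three_of_cp
    (hG : CossartPiltant2019General.{0}) (h081R : Stacks081R.{0}) (hP : CossartPiltant2019Principalization.{0}) (p : ℕ) :
    ClosedPointLocalResolutionAdm.ClosedPointLocalResolutionAdm p 3 := by
  intro K _ _ Y g _ hl _ hi hd y hy S' g' I hg' _ _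
  haveI := hl
  haveI := hi
  exact LocalBlowupDesingularizationDimThree.admitsDesingularization_of_isBlowup_stalk_dimThree hG h081R hP g y
    (FTemkinClosedPoints.ringKrullDim_stalk_eq_of_isClosed g hd y hy) S' g' I hg'

/-- **Level `3` of the transcendental-field rung is a theorem** modulo {CP 1.1, R–G 081R, CP 4.4}. [OURS · conditional-result]
[cite: CossartPiltant2019, Thm. 1.1 (i)(ii); Prop. 4.4] [cite: Temkin2008, Prop. 2.3.4 (iii)] -/
theorem closedPointLocalResolutionAdmTr_three_of_cp
    (hG : CossartPiltant2019General.{0}) (h081R : Stacks081R.{0}) (hP : CossartPiltant2019Principalization.{0}) (p r : ℕ) :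
    ClosedPointLocalResolutionAdmTr.ClosedPointLocalResolutionAdmTr p 3 r :=
  ClosedPointLocalResolutionAdmTr.closedPointLocalResolutionAdmTr_of_adm (closedPointLocalResolutionAdm_three_of_cp hG h081R hP p) r

end Summit.ResolutionOfSingularities.ResolutionOfSingularities.Theorems.FInjectiveMacaulayfication.ClosedPointLocalResolutionAdmDimThree

end
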